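import Literature.AlgebraicGeometry.Motives.HodgeDecompositionIsInternalDolbeaultProofs
import Literature.Geometry.Kaehler.TorusDolbeaultRegularityPq
import HarnessLib

/-!
# The Hodge decomposition `H^k_dR(M; ℂ) = ⨁_{p+q=k} K^{p,q}` holds (discharge of `isInternal_hodgePQ`)

Trunk **T-KAEHLER** (`AlgebraicGeometry/Motives`). Theorems-only leaf companion of
`HodgeDecomposition.lean` (the named fact `Literature.AlgebraicGeometry.Motives.isInternal_hodgePQ`,
**hodge.S07**: on a compact Kähler manifold the subspaces `hodgePQ E M k p q` of de Rham classes of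
closed `(p,q)`-forms — Voisin's `K^{p,q}` — with `p + q = k` form an internal direct sum
decomposition of `H^k_dR(M; ℂ)`; C. Voisin, *Hodge Theory and Complex Algebraic Geometry I* (2002),
§6.1.3, PDF p. 121, with Prop. 6.11 and Cor. 6.14) and of its reduction files
`HodgeDecompositionIsInternalProofs`, `…IsInternalKaehlerProofs`, `…IsInternalDolbeaultProofs`.

`HodgeDecompositionIsInternalDolbeaultProofs.isInternal_hodgePQ_of_dolbeault_regularity_of_compactness`
reduces the fact, along Voisin's printed route (Thm. 5.22 ⇒ Thm. 5.24 ⇒ Thm. 6.7 `Δ_d = 2Δ_∂̄` ⇒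
Thm. 5.23 / Cor. 6.10 ⇒ Prop. 6.11), to F. W. Warner's two analytic theorems for the elliptic
operator `Δ_∂̄` on the Hermitian inner product spaces `A^{p,q}(M)` of smooth `(p,q)`-forms of a
compact complex manifold (*Foundations of Differentiable Manifolds and Lie Groups*, GTM 94 (1983),
p. 222): **6.6 (compactness)** — a sequence `(u_i)` with `‖u_i‖ ≤ c` and `‖Δ_∂̄ u_i‖ ≤ c` has an
`L²`-Cauchy subsequence — and **6.5 (regularity)** — a bounded weak solution `ℓ` of `Δ_∂̄ ω = α`,
`ℓ(Δ_∂̄ φ) = ⟪α, φ⟫`, is `⟪w, ·⟫` for a smooth `w ∈ A^{p,q}(M)`. Both are now theorems of the tree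
(the periodic-elliptic programme `Literature/Geometry/Kaehler/TorusDolbeault*.lean`: Warner
§§6.29–6.33 on the Fourier lattice, transported through holomorphic charts and glued by a partition
of unity): `Literature.Geometry.Kaehler.CL2SmoothForms.pq_compact` (`TorusDolbeaultCompactAll`) and
`Literature.Geometry.Kaehler.CL2SmoothForms.pq_regular` (`TorusDolbeaultRegularityPq`), exactly as
they are fed to the Frölicher inequality in `DeRhamComparisonEllipticReductionProofs`. Hence:

* `isInternal_hodgePQ_holds` — **discharge of the named fact `isInternal_hodgePQ`** (all universes,
  every finite-dimensional complex model space `E`, every real-`C^∞` manifold `M` charted on `E`;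
  the hypotheses "compact complex Kähler" are the binders inside the fact);
* `directSum_isInternal_hodgePQ` — the same with the instances as ordinary binders:
  `H^k_dR(M; ℂ) = ⨁_{p+q=k} K^{p,q}(M)` for a compact Hausdorff Kähler manifold;
* `iSup_hodgePQ_eq_top_holds` — the spanning half `⨆_{p+q=k} K^{p,q} = H^k_dR(M; ℂ)`, read off the
  internal direct sum (the tree's `iSup_hodgePQ_eq_top` fed the discharge).

No definition and no named fact is introduced (D-0026).

## References

* C. Voisin, *Hodge Theory and Complex Algebraic Geometry I*, Cambridge Studies in Advanced
  Mathematics 76 (2002), §5.2.3 Thm. 5.22, §5.3.1 Thms. 5.23–5.24, §6.1.2 Thm. 6.7, §6.1.3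
  (PDF p. 121) Prop. 6.11, Cor. 6.14. [Voisin2002] [VoisinHodgeI2002]
* F. W. Warner, *Foundations of Differentiable Manifolds and Lie Groups*, GTM 94 (1983), Thms. 6.5,
  6.6 (p. 222), 6.8, 6.11. [WarnerGTM94]
* W. V. D. Hodge, *The Theory and Applications of Harmonic Integrals* (1941).
-/

noncomputable section

open scoped Manifold ContDiff Topology ComplexInnerProductSpace
open Bundle Finset

namespace Literature.AlgebraicGeometry.Motives

open Literature.Geometry.Kaehler Literature.NumberTheory.Transcendental

variable {E : Type*} [NormedAddCommGroup E] [NormedSpace ℂ E]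
  {M : Type*} [TopologicalSpace M] [ChartedSpace E M] [FiniteDimensional ℂ E]
  [IsManifold 𝓘(ℝ, E) ∞ M]

/-- **hodge.S07, the Hodge decomposition — discharge of the named fact `isInternal_hodgePQ`.**
For a compact Kähler manifold `M` (compact Hausdorff complex manifold admitting a Kähler metric,
`IsKaehlerManifold E M`) and every `k`, the subspaces `K^{p,q} = hodgePQ E M k p q ⊆ H^k_dR(M; ℂ)`
of classes of closed `(p,q)`-forms, `p + q = k`, form an internal direct sum decomposition
`H^k_dR(M; ℂ) = ⨁_{p+q=k} K^{p,q}` (Voisin (2002), §6.1.3 with Prop. 6.11: `H^{p,q} = K^{p,q}`).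
Proof: `isInternal_hodgePQ_of_dolbeault_regularity_of_compactness` (Voisin's route through the
harmonic theory of `Δ_∂̄` and `Δ_d = 2Δ_∂̄`) fed with Warner's Theorem 6.6 (compactness,
`CL2SmoothForms.pq_compact`) and Theorem 6.5 (regularity of weak solutions,
`CL2SmoothForms.pq_regular`) for `Δ_∂̄` on the spaces `A^{p,q}(M)`, both proved in
`Literature/Geometry/Kaehler/TorusDolbeault*.lean`.
[cite: Voisin2002, §6.1.3 Prop. 6.11] [cite: WarnerGTM94, Thms. 6.5, 6.6, p. 222] -/
theorem isInternal_hodgePQ_holds : isInternal_hodgePQ (E := E) (M := M) := by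
  refine isInternal_hodgePQ_of_dolbeault_regularity_of_compactness (E := E) (M := M) ?_ ?_
  · intro _ _ _ _ _ n _ g hJ o p q m h ho
    letI : RiemannianBundle (fun x : M ↦ TangentSpace 𝓘(ℝ, E) x) := ⟨g.toRiemannianMetric⟩
    haveI : IsContMDiffRiemannianBundle 𝓘(ℝ, E) ∞ E (fun x : M ↦ TangentSpace 𝓘(ℝ, E) x) :=
      ⟨g.inner, g.contMDiff, fun _ _ _ ↦ rfl⟩
    haveI : Fact (IsSmoothForm (riemannianVolumeForm o)) := ⟨ho⟩
    exact fun u c hb hΔ ↦ CL2SmoothForms.pq_compact o hJ p q h u c hb hΔ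
  · intro _ _ _ _ _ n _ g hJ o p q m h ho
    letI : RiemannianBundle (fun x : M ↦ TangentSpace 𝓘(ℝ, E) x) := ⟨g.toRiemannianMetric⟩
    haveI : IsContMDiffRiemannianBundle 𝓘(ℝ, E) ∞ E (fun x : M ↦ TangentSpace 𝓘(ℝ, E) x) :=
      ⟨g.inner, g.contMDiff, fun _ _ _ ↦ rfl⟩
    haveI : Fact (IsSmoothForm (riemannianVolumeForm o)) := ⟨ho⟩
    exact fun α ℓ hw ↦ CL2SmoothForms.pq_regular o hJ p q h α ℓ hw

/-- **The Hodge decomposition of a compact Kähler manifold** (Hodge (1941); Voisin (2002), §6.1.3,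
p. 121, Prop. 6.11 and Cor. 6.14), instances as binders: `H^k_dR(M; ℂ) = ⨁_{p+q=k} K^{p,q}(M)`, the
`K^{p,q} = hodgePQ E M k p q` being independent and spanning. [cite: Voisin2002, §6.1.3 Prop. 6.11] -/
theorem directSum_isInternal_hodgePQ [IsManifold 𝓘(ℂ, E) ω M] [CompactSpace M] [T2Space M]
    [IsKaehlerManifold E M] (k : ℕ) :
    DirectSum.IsInternal fun pq : ↥(antidiagonal k) ↦ hodgePQ E M k pq.1.1 pq.1.2 :=
  isInternal_hodgePQ_holds k

/-- **Spanning half of the Hodge decomposition, unconditionally** (Voisin (2002), §6.1.3, p. 121):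
on a compact Kähler manifold every complex de Rham class is a sum of classes of closed forms of
pure type, `⨆_{p+q=k} K^{p,q} = H^k_dR(M; ℂ)` (the tree's `iSup_hodgePQ_eq_top` fed
`isInternal_hodgePQ_holds`). [cite: Voisin2002, §6.1.3] -/
theorem iSup_hodgePQ_eq_top_holds [IsManifold 𝓘(ℂ, E) ω M] [CompactSpace M] [T2Space M]
    [IsKaehlerManifold E M] (k : ℕ) :
    ⨆ pq ∈ antidiagonal k, hodgePQ E M k pq.1 pq.2 = ⊤ :=
  iSup_hodgePQ_eq_top isInternal_hodgePQ_holds k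

end Literature.AlgebraicGeometry.Motives

end
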